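import Mathlib.Order.PiLex
import Mathlib.Combinatorics.SimpleGraph.Maps
import Literature.MathematicalPhysics.QuantumLattice.FinDimSpectrum
import Literature.MathematicalPhysics.QuantumLattice.LatticeTori
import Literature.MathematicalPhysics.QuantumLattice.FermionOperators
import Literature.Probability.LatticeModels.LatticeGraph
import HarnessLib

-- provenance: harness21/H21/H21/Prelude/QLatticeAQFT/HubbardModel.lean @ 0631ff5 (interim HEAD d8f2665); M5 mechanical rewrite
/-!
# The Hubbard model: chemical potential, fermionic tori, sectors and energies

Trunk T-QLATTICE (prelude item Q7 `HubbardModel`, notions `hubbard_hamiltonian`,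
`number_operator_filling`), family `hubbard`. Additions over the accepted wave-0 Hubbard
Hamiltonian `Literature.Hubbard.hamiltonian G t U` (REUSED, never redefined; likewise `numberOp`,
`totalNumber`, `spinZ`, `groundEnergy`, `IsGroundState`, `filling`, `doping`).

## Contents

* `hamiltonianWith G t U μ = hamiltonian G t U - μ N` (grand-canonical Hubbard Hamiltonian).
* Fermionic carriers with a `LinearOrder` (needed by the Jordan–Wigner construction of Wave0;
  `ZMod L` has none): `FermionTorus d L = Lex (Fin d → Fin L)` with the comparison maps
  `FermionTorus.toTorusSite`, `FermionTorus.ofTorusSite` to `StatMech.TorusSite d L = Fin d → ZMod L`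
  (outline §0 long-range-order convention, `LatticeTori.HasTorusLRO`), and the nearest-neighbour
  graph `fermionTorusGraph d L`, the pull-back (`SimpleGraph.comap`) of `StatMech.torusGraph d L`;
  similarly `FermionBox d L = Lex (Fin d → Fin (2L+1))` with `fermionBoxGraph` pulled back from
  `StatMech.zdGraph d` along `FermionBox.toSite` (free boundary conditions on `{-L,…,L}^d`).
* `hubbardTorus d L t U`, `hubbardTorusWith d L t U μ`; the bipartite sign `torusStagger`; Yang's
  `η`-pairing states `etaPairingState ε m = (η†)^m |0⟩`.
* Energies and sectors: `groundEnergyAt`, `chargeGap`, `energyPerSite`, the joint `(N, S^z)` sector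
  `szSector N M` and `IsGroundStateInSector H N M ψ`.
* API lemmas (proofs `sorry`): particle–hole symmetry on bipartite graphs, `SU(2)` invariance,
  Yang's commutator `[H, η†] = (U - 2μ) η†`, hermiticity of `hubbardTorus`.

## Mathlib search

Mathlib provides `Pi.Lex.linearOrder` (`Mathlib.Order.PiLex`), `Lex.fintype`, `SimpleGraph.comap`
with its `DecidableRel` instance (`Mathlib.Combinatorics.SimpleGraph.Maps`), `ZMod.val`,
`ZMod.natCast_zmod_val`, `ZMod.val_cast_of_lt`, `Module.End.eigenspace`; it has no Hubbard model,
Fock space or `η`-pairing (`rg -i hubbard` in Mathlib: nothing). All definitions here are thin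
wrappers around Wave0 / `FermionOperators` / `StatMech.LatticeGraph`.

## Design notes

* `chargeGap G t U N = E(N+1) + E(N-1) - 2E(N)` uses truncated subtraction `N - 1`; at `N = 0`
  the value `E(1) - E(0)` is a documented junk value (statements use `N = |Λ| ≥ 1`).
* `etaPairingState ε m` is indexed by the number `m` of `η`-pairs (a `2m`-particle state), avoiding
  the `N / 2` of the informal `(η†)^{N/2} |0⟩`.
* `szSector N M` takes the `S^z` eigenvalue `M : ℝ` (half-integers allowed) and is the intersection
  of `nParticleSubmodule N` with the `M`-eigenspace of `spinZ`.
* `torusStagger x = (-1)^{Σᵢ xᵢ}` with `xᵢ ∈ {0,…,L-1}` is a consistent sublattice sign on the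
  torus only for even `L`; lemmas using it assume `Even L`.

## Sources

J. Hubbard, Proc. R. Soc. A 276 (1963) 238; E. H. Lieb, *Two theorems on the Hubbard model*,
PRL 62 (1989) 1201; C. N. Yang, *η pairing and ODLRO in a Hubbard model*, PRL 63 (1989) 2144;
E. H. Lieb, F. Y. Wu, PRL 20 (1968) 1445; H. Tasaki, *Physics and Mathematics of Quantum
Many-Body Systems* (2020) §§9.3, 10.
-/

noncomputable section

namespace Literature.MathematicalPhysics.QuantumLattice

open Matrix Finset HubbardWave0 Literature.Probability.LatticeModels
open scoped ComplexOrder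

/-! ### Chemical potential -/

section General

variable {Λ : Type*} [LinearOrder Λ] [Fintype Λ] (G : SimpleGraph Λ) [DecidableRel G.Adj]

/-- The grand-canonical Hubbard Hamiltonian `H(t, U) - μ N` with chemical potential `μ`.
Lieb, PRL 62 (1989) 1201; Tasaki (2020) §10.1. [cite: Tasaki2020] -/
def hamiltonianWith (t U μ : ℝ) : Matrix (Finset (Orb Λ)) (Finset (Orb Λ)) ℂ :=
  hamiltonian G t U - (μ : ℂ) • totalNumber

/-- `hamiltonianWith G t U μ = hamiltonian G t U - μ N` (definitional). Tasaki (2020) §10.1. [cite: Tasaki2020] -/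
theorem hamiltonianWith_eq (t U μ : ℝ) :
    hamiltonianWith G t U μ = hamiltonian G t U - (μ : ℂ) • totalNumber := rfl

/-- At `μ = 0` the grand-canonical Hamiltonian is the Hubbard Hamiltonian. Tasaki (2020) §10.1. [cite: Tasaki2020] -/
@[simp] theorem hamiltonianWith_zero (t U : ℝ) : hamiltonianWith G t U 0 = hamiltonian G t U := by
  simp [hamiltonianWith]

/-! ### Energies and sectors -/

/-- The ground-state energy `E(N)` of the Hubbard Hamiltonian on `G` in the `N`-particle sector
(Wave0 `Hubbard.groundEnergy`; junk value `0` for `N > 2|Λ|`). Lieb–Wu, PRL 20 (1968) 1445. [folklore] -/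
def groundEnergyAt (t U : ℝ) (N : ℕ) : ℝ := groundEnergy (hamiltonian G t U) N

/-- The charge gap `Δ_c(N) = E(N+1) + E(N-1) - 2E(N)` (Mott gap at half filling `N = |Λ|`).
Junk value at `N = 0`: truncated subtraction gives `E(1) - E(0)`.
Lieb–Wu, PRL 20 (1968) 1445, eq. (17). [folklore] -/
def chargeGap (t U : ℝ) (N : ℕ) : ℝ :=
  groundEnergyAt G t U (N + 1) + groundEnergyAt G t U (N - 1) - 2 * groundEnergyAt G t U N

/-- The ground-state energy per site `E(N)/|Λ|` (junk value `0` for empty `Λ`).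
Lieb–Wu, PRL 20 (1968) 1445. [folklore] -/
def energyPerSite (t U : ℝ) (N : ℕ) : ℝ := groundEnergyAt G t U N / Fintype.card Λ

/-- The joint sector of particle number `N` and `S^z = M`: the intersection of the `N`-particle
sector with the `M`-eigenspace of `spinZ` (`M ∈ ½ℤ` in practice; other `M` give `⊥` on the
`N`-sector). Lieb, PRL 62 (1989) 1201. [folklore] -/
def szSector (N : ℕ) (M : ℝ) : Submodule ℂ (Fock (Orb Λ)) :=
  nParticleSubmodule N ⊓
    Module.End.eigenspace (Matrix.toLin' (spinZ : Matrix (Finset (Orb Λ)) _ ℂ)) (M : ℂ)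

/-- Membership in the joint sector, unfolded. Lieb, PRL 62 (1989) 1201. [folklore] -/
theorem mem_szSector_iff (N : ℕ) (M : ℝ) (ψ : Fock (Orb Λ)) :
    ψ ∈ szSector N M ↔ IsNParticle N ψ ∧ spinZ *ᵥ ψ = (M : ℂ) • ψ := by
  simp [szSector]

/-- `ψ` is a ground state of `H` in the joint sector `(N, S^z = M)`: a nonzero vector of
`szSector N M` which is an eigenvector of `H` with eigenvalue the lowest energy
`H.minEnergyOn (szSector N M)` of `H` in that sector. Intended for Hermitian `H` preserving the
sector (e.g. `hamiltonian G t U`). Lieb, PRL 62 (1989) 1201. [folklore] -/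
def IsGroundStateInSector (H : Matrix (Finset (Orb Λ)) (Finset (Orb Λ)) ℂ) (N : ℕ) (M : ℝ)
    (ψ : Fock (Orb Λ)) : Prop :=
  ψ ∈ szSector N M ∧ ψ ≠ 0 ∧ H *ᵥ ψ = ((H.minEnergyOn (szSector N M) : ℝ) : ℂ) • ψ

/-! ### Symmetries of the Hubbard Hamiltonian -/

/-- Particle–hole symmetry on a bipartite graph. Let `ε : Λ → ℤˣ` be a bipartite sign
(`ε x = -ε y` on every edge) and `P = particleHole ε'` the full particle–hole transformation with
phases `ε' (x, σ) = ε x` (`c_{xσ} ↦ ε_x c†_{xσ}`). Then the hopping term is invariant and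
`P H(t,U) Pᴴ = H(t,U) - U N + U|Λ|`. Lieb, PRL 62 (1989) 1201; Tasaki (2020) §9.3.3. [cite: Tasaki2020] -/
def hamiltonian_particleHole_bipartite : Prop :=
  ∀ (t U : ℝ) (ε : Λ → ℤˣ) (hε : ∀ x y, G.Adj x y → ε x = -ε y),
    particleHole (fun i : Orb Λ => ((ε (ofLex i).1 : ℤ) : ℂ)) * hamiltonian G t U *
        (particleHole (fun i : Orb Λ => ((ε (ofLex i).1 : ℤ) : ℂ)))ᴴ =
      hamiltonian G t U - (U : ℂ) • totalNumber + ((U * Fintype.card Λ : ℝ) : ℂ) • 1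

/-- Global `SU(2)` invariance: the Hubbard Hamiltonian commutes with every component of the
total spin. Lieb, PRL 62 (1989) 1201; Tasaki (2020) §9.3.2. [cite: Tasaki2020] -/
def commute_hamiltonian_spinVecF : Prop :=
  ∀ (t U : ℝ) (α : Fin 3),
    Commute (hamiltonian G t U) (spinVecF α)

/-- The grand-canonical Hamiltonian also commutes with the total spin (`N` commutes with `S`).
Tasaki (2020) §9.3.2. [cite: Tasaki2020] -/
def commute_hamiltonianWith_spinVecF : Prop :=
  ∀ (t U μ : ℝ) (α : Fin 3),
    Commute (hamiltonianWith G t U μ) (spinVecF α)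

/-- The grand-canonical Hamiltonian is Hermitian and conserves the particle number.
Lieb, arXiv:cond-mat/9311033 §2. [cite: arXiv9311033] -/
def hamiltonianWith_isHermitian_and_commute : Prop :=
  ∀ (t U μ : ℝ),
    (hamiltonianWith G t U μ).IsHermitian ∧ Commute (hamiltonianWith G t U μ) totalNumber

end General

/-! ### Fermionic tori and boxes -/

/-- The vertex set of the fermionic discrete torus `(ℤ/Lℤ)^d`, realised as `Fin d → Fin L` with
the lexicographic linear order (Mathlib `Pi.Lex.linearOrder`); the Jordan–Wigner construction of
Wave0 needs a `LinearOrder`, which `ZMod L` lacks. Compare `StatMech.TorusSite d L = Fin d → ZMod L`.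
Lieb–Wu, PRL 20 (1968) 1445 (`d = 1`); Tasaki (2020) §9.3. [cite: Tasaki2020] -/
abbrev FermionTorus (d L : ℕ) : Type := Lex (Fin d → Fin L)

namespace FermionTorus

variable {d L : ℕ}

/-- The comparison map to the statistical-mechanics torus `Fin d → ZMod L`,
`x ↦ (i ↦ (xᵢ : ZMod L))` (outline §0 long-range-order convention). Friedli–Velenik (2017) §3.1. [cite: FriedliVelenik2017] -/
def toTorusSite (x : FermionTorus d L) : TorusSite d L := fun i => ((ofLex x i : ℕ) : ZMod L)

/-- `toTorusSite` in coordinates. Friedli–Velenik (2017) §3.1. [cite: FriedliVelenik2017] -/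
@[simp] theorem toTorusSite_apply (x : FermionTorus d L) (i : Fin d) :
    toTorusSite x i = ((ofLex x i : ℕ) : ZMod L) := rfl

/-- The inverse comparison map `Fin d → ZMod L → FermionTorus d L`, via canonical representatives
`ZMod.val` (needs `L ≠ 0`). Friedli–Velenik (2017) §3.1. [cite: FriedliVelenik2017] -/
def ofTorusSite [NeZero L] (x : TorusSite d L) : FermionTorus d L :=
  toLex fun i => ⟨(x i).val, ZMod.val_lt (x i)⟩

/-- `ofTorusSite` in coordinates. Friedli–Velenik (2017) §3.1. [cite: FriedliVelenik2017] -/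
theorem ofLex_ofTorusSite_apply [NeZero L] (x : TorusSite d L) (i : Fin d) :
    (ofLex (ofTorusSite x) i : ℕ) = (x i).val := rfl

/-- `toTorusSite ∘ ofTorusSite = id`. Friedli–Velenik (2017) §3.1. [cite: FriedliVelenik2017] -/
@[simp] theorem toTorusSite_ofTorusSite [NeZero L] (x : TorusSite d L) :
    toTorusSite (ofTorusSite x) = x := by
  funext i
  simp [toTorusSite, ofTorusSite]

/-- `ofTorusSite ∘ toTorusSite = id`. Friedli–Velenik (2017) §3.1. [cite: FriedliVelenik2017] -/
@[simp] theorem ofTorusSite_toTorusSite [NeZero L] (x : FermionTorus d L) :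
    ofTorusSite (toTorusSite x) = x := by
  refine (toLex_ofLex x).symm.trans ?_ |>.symm
  unfold ofTorusSite toTorusSite
  congr 1
  funext i
  ext
  exact (ZMod.val_cast_of_lt (ofLex x i).isLt).symm

/-- The comparison maps assemble to a bijection `FermionTorus d L ≃ TorusSite d L` (`L ≠ 0`).
Friedli–Velenik (2017) §3.1. [cite: FriedliVelenik2017] -/
def equivTorusSite [NeZero L] : FermionTorus d L ≃ TorusSite d L where
  toFun := toTorusSite
  invFun := ofTorusSite
  left_inv := ofTorusSite_toTorusSite
  right_inv := toTorusSite_ofTorusSite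

end FermionTorus

/-- The nearest-neighbour graph on the fermionic torus: the pull-back (`SimpleGraph.comap`) of
`StatMech.torusGraph d L` along `FermionTorus.toTorusSite`, so `x ∼ y ↔ toTorusSite x ∼ toTorusSite y`.
Friedli–Velenik (2017) §3.1; Lieb–Wu, PRL 20 (1968) 1445. [cite: FriedliVelenik2017] -/
def fermionTorusGraph (d L : ℕ) : SimpleGraph (FermionTorus d L) :=
  (torusGraph d L).comap FermionTorus.toTorusSite

/-- Adjacency on the fermionic torus is adjacency of the images in `StatMech.torusGraph`.
Friedli–Velenik (2017) §3.1. [cite: FriedliVelenik2017] -/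
@[simp] theorem fermionTorusGraph_adj {d L : ℕ} (x y : FermionTorus d L) :
    (fermionTorusGraph d L).Adj x y ↔ (torusGraph d L).Adj x.toTorusSite y.toTorusSite := Iff.rfl

/-- Adjacency on the fermionic torus is decidable (Mathlib's instance for `SimpleGraph.comap`
applied to the decidable `torusGraph`). Friedli–Velenik (2017) §3.1. [cite: FriedliVelenik2017] -/
instance instDecidableRelFermionTorusGraphAdj {d L : ℕ} :
    DecidableRel (fermionTorusGraph d L).Adj :=
  inferInstanceAs (DecidableRel ((torusGraph d L).comap FermionTorus.toTorusSite).Adj)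

/-- The vertex set of the fermionic box `{-L, …, L}^d` (free boundary conditions), realised as
`Fin d → Fin (2L+1)` with the lexicographic linear order. Compare `StatMech.box d L ⊆ Site d`.
Friedli–Velenik (2017) §3.2; Tasaki (2020) §9.3. [cite: FriedliVelenik2017] -/
abbrev FermionBox (d L : ℕ) : Type := Lex (Fin d → Fin (2 * L + 1))

namespace FermionBox

/-- The comparison map to `ℤ^d`, `x ↦ (i ↦ xᵢ - L)`, with image `StatMech.box d L = {-L,…,L}^d`.
Friedli–Velenik (2017) §3.2. [cite: FriedliVelenik2017] -/
def toSite {d L : ℕ} (x : FermionBox d L) : Site d := fun i => ((ofLex x i : ℕ) : ℤ) - L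

/-- `toSite` in coordinates. Friedli–Velenik (2017) §3.2. [cite: FriedliVelenik2017] -/
@[simp] theorem toSite_apply {d L : ℕ} (x : FermionBox d L) (i : Fin d) :
    toSite x i = ((ofLex x i : ℕ) : ℤ) - L := rfl

/-- `toSite` lands in the centred box `StatMech.box d L`. Friedli–Velenik (2017) §3.2. [cite: FriedliVelenik2017] -/
theorem toSite_mem_box {d L : ℕ} (x : FermionBox d L) : toSite x ∈ box d L := by
  rw [mem_box]
  intro i
  have h := (ofLex x i).isLt
  simp only [toSite_apply]
  omega

end FermionBox

/-- The nearest-neighbour graph on the fermionic box: the pull-back of `StatMech.zdGraph d` along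
`FermionBox.toSite`. Friedli–Velenik (2017) §3.2. [cite: FriedliVelenik2017] -/
def fermionBoxGraph (d L : ℕ) : SimpleGraph (FermionBox d L) :=
  (zdGraph d).comap FermionBox.toSite

/-- Adjacency on the fermionic box is adjacency of the images in `ℤ^d`.
Friedli–Velenik (2017) §3.2. [cite: FriedliVelenik2017] -/
@[simp] theorem fermionBoxGraph_adj {d L : ℕ} (x y : FermionBox d L) :
    (fermionBoxGraph d L).Adj x y ↔ (zdGraph d).Adj x.toSite y.toSite := Iff.rfl

/-- Adjacency on the fermionic box is decidable. Friedli–Velenik (2017) §3.2. [cite: FriedliVelenik2017] -/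
instance instDecidableRelFermionBoxGraphAdj {d L : ℕ} :
    DecidableRel (fermionBoxGraph d L).Adj :=
  inferInstanceAs (DecidableRel ((zdGraph d).comap FermionBox.toSite).Adj)

/-! ### The Hubbard model on the torus -/

section Torus

variable (d L : ℕ)

/-- The Hubbard Hamiltonian `H(t, U)` on the discrete torus `(ℤ/Lℤ)^d` (periodic boundary
conditions). Lieb–Wu, PRL 20 (1968) 1445; Lieb, PRL 62 (1989) 1201. [folklore] -/
def hubbardTorus (t U : ℝ) :
    Matrix (Finset (Orb (FermionTorus d L))) (Finset (Orb (FermionTorus d L))) ℂ :=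
  hamiltonian (fermionTorusGraph d L) t U

/-- The grand-canonical Hubbard Hamiltonian `H(t, U) - μ N` on the discrete torus.
Koma–Tasaki, PRL 68 (1992) 3248; Tasaki (2020) §10.1. [cite: Tasaki2020] -/
def hubbardTorusWith (t U μ : ℝ) :
    Matrix (Finset (Orb (FermionTorus d L))) (Finset (Orb (FermionTorus d L))) ℂ :=
  hamiltonianWith (fermionTorusGraph d L) t U μ

/-- `hubbardTorusWith d L t U μ = hubbardTorus d L t U - μ N` (definitional). Tasaki (2020) §10.1. [cite: Tasaki2020] -/
theorem hubbardTorusWith_eq (t U μ : ℝ) :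
    hubbardTorusWith d L t U μ = hubbardTorus d L t U - (μ : ℂ) • totalNumber := rfl

/-- At `μ = 0`, `hubbardTorusWith` is `hubbardTorus`. Tasaki (2020) §10.1. [cite: Tasaki2020] -/
@[simp] theorem hubbardTorusWith_zero (t U : ℝ) :
    hubbardTorusWith d L t U 0 = hubbardTorus d L t U :=
  hamiltonianWith_zero _ t U

variable {d L}

/-- The bipartite (staggering) sign `ε_x = (-1)^{Σᵢ xᵢ} ∈ ℤˣ` on the fermionic torus, computed
on representatives `xᵢ ∈ {0, …, L-1}`. Neighbours carry opposite signs only when `L` is even.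
Lieb, PRL 62 (1989) 1201; Yang, PRL 63 (1989) 2144 (`e^{iπ·x}`). [folklore] -/
def torusStagger (x : FermionTorus d L) : ℤˣ := (-1) ^ (∑ i, (ofLex x i : ℕ))

/-- `torusStagger` unfolded. Yang, PRL 63 (1989) 2144. [folklore] -/
theorem torusStagger_apply (x : FermionTorus d L) :
    torusStagger x = (-1) ^ (∑ i, (ofLex x i : ℕ)) := rfl

/-- On a torus of even side, nearest neighbours carry opposite staggering signs (bipartiteness).
Lieb, PRL 62 (1989) 1201. [cite: LiebPRL1989, Theorem 2 (bipartite lattice)] -/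
def torusStagger_eq_neg_of_adj : Prop :=
  ∀ (hL : Even L) {x y : FermionTorus d L} (h : (fermionTorusGraph d L).Adj x y),
    torusStagger x = -torusStagger y

/-- Yang's `η`-pairing state with `m` pairs, `(η†_ε)^m |0⟩`, a `2m`-particle state (the informal
`(η†)^{N/2}|0⟩` with `N = 2m`). Yang, PRL 63 (1989) 2144, eq. (7). [folklore] -/
def etaPairingState {Λ : Type*} [LinearOrder Λ] [Fintype Λ] (ε : Λ → ℤˣ) (m : ℕ) :
    Fock (Orb Λ) :=
  (etaRaise ε) ^ m *ᵥ vacuum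

/-- The `η`-pairing state with `m` pairs has `2m` particles. Yang, PRL 63 (1989) 2144. [cite: Yang1989, eq. (7)] -/
def isNParticle_etaPairingState : Prop :=
  ∀ {Λ : Type*} [LinearOrder Λ] [Fintype Λ] (ε : Λ → ℤˣ) (m : ℕ),
    IsNParticle (2 * m) (etaPairingState ε m)

/-- The torus Hubbard Hamiltonian is Hermitian (given the named fact
`hamiltonian_isHermitian_and_commute` for the torus graph, threaded as hypothesis `h`).
Lieb, arXiv:cond-mat/9311033 §2. [cite: arXiv9311033] -/
theorem hubbardTorus_isHermitian
    (h : hamiltonian_isHermitian_and_commute (fermionTorusGraph d L)) (t U : ℝ) :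
    (hubbardTorus d L t U).IsHermitian :=
  (h t U).1

/-- The grand-canonical torus Hubbard Hamiltonian is Hermitian (given the named fact
`hamiltonianWith_isHermitian_and_commute` for the torus graph, threaded as hypothesis `h`).
Lieb, arXiv:cond-mat/9311033 §2. [cite: arXiv9311033] -/
theorem hubbardTorusWith_isHermitian
    (h : hamiltonianWith_isHermitian_and_commute (fermionTorusGraph d L)) (t U μ : ℝ) :
    (hubbardTorusWith d L t U μ).IsHermitian :=
  (h t U μ).1

/-- Yang's commutator: on a torus of even side (bipartite, `ε = torusStagger`) the hopping term
commutes with `η†`, and `[H(t,U) - μN, η†] = (U - 2μ) η†`; hence `(η†)^m |0⟩` is an eigenstate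
with energy `m (U - 2μ)`. Yang, PRL 63 (1989) 2144, eq. (6). [cite: Yang1989, eq. (6)] -/
def etaRaise_commutator : Prop :=
  ∀ (hL : Even L) (t U μ : ℝ),
    hubbardTorusWith d L t U μ * etaRaise torusStagger -
        etaRaise torusStagger * hubbardTorusWith d L t U μ =
      ((U - 2 * μ : ℝ) : ℂ) • etaRaise torusStagger

/-- Consequence: the `η`-pairing states are exact eigenstates of the torus Hubbard Hamiltonian,
`H(t,U) (η†)^m |0⟩ = m U (η†)^m |0⟩`, for every `U`. Yang, PRL 63 (1989) 2144, eq. (8). [cite: Yang1989, eq. (8)] -/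
def hubbardTorus_mulVec_etaPairingState : Prop :=
  ∀ (hL : Even L) (t U : ℝ) (m : ℕ),
    hubbardTorus d L t U *ᵥ etaPairingState torusStagger m =
      ((m * U : ℝ) : ℂ) • etaPairingState torusStagger m

end Torus

end Literature.MathematicalPhysics.QuantumLattice
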